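import Summits.BirchSwinnertonDyer.BirchSwinnertonDyer.Theorems.SchneiderFreeAdditiveX3ArtinLinkGenusLocal
import HarnessLib

/-!
# Route `SchneiderFreeAdditiveX3` (K1 door), cruxes `PotMultBranchIMC` / `GordTwoBranchIMC`
# (items stmt-BirchSwinnertonDyer-19176 / 19177): the ARTIN LINK for the genus character, PROVED —
# `L′(f_V, χ_gal, 1) = L′(E/K, 1)` in Galois currency, no `(c, N) = 1`, no cite-only input (want W2)

Cell `bsd-schneider-ideate`, seat `bsd-schneider-door-c4` (prover, generation 8). HONEST FRAMING:
theorems only (no definition, no named fact, nothing asserted about BSD; both cruxes stay OPEN).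
FILE 3b of W2 (§3–§4 here; §1–§2 in `…ArtinLinkGenusLocal.lean`; after `…GaloisHeckeValues.lean`, `…GenusCharacterValues.lean`).

The layer-2 value road of both door cells evaluates Cai–Shu–Tian's explicit Gross–Zagier formula
(Thm 1.1 on (G), door-c3; Thm 1.5 on (M), door-c2 g8) at the genus character `χ` of conductor `p`;
its left-hand side is `rankinSelbergDerivValue Dt_V.f χ_gal 1`, the derivative at `s = 1` of the
continued Rankin–Selberg `L`-function of `f_V` over `K` twisted by `χ_gal` in the tree's GALOIS
currency (`rankinSelbergEulerProduct`, Nekovář (0.5)), and the road needs the ARTIN LINK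
`rankinSelbergDerivValue Dt_V.f χ_gal 1 = LDerivEK W K` (= `(L(W,·)·L(W^{(d_K)},·))′(1)`) for the
door's curve `W = C • (V ⊗ χ_{p*})`. On (G) door-c3 derived it from the CITE-ONLY fact
`Gross2004.rankinLSeries_eq_mul_quadraticTwist` (Gross 2004 §2: `L(f, χ, s) = L(A₁, s)L(A₂, s)`,
vendored WITH Gross's standing hypothesis `(c, N) = 1`); on (M) that fact does not apply
(`c = p ∥ N_V`) and door-c2 g8 carries `hArtin` as a hypothesis (FINDING-door-c2-g8 §2, want W2).
This file PROVES the link, for both cells, from tree theorems only: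

* §1 the Rankin–Selberg local factor (Galois currency) at a place of residue degree `d`, and its
  eigenvalue form `(1 − (εα₀)^d T)(1 − (εβ₀)^d T)` when `heckeValueAt χ v = ε^d`;
* §2 over `ℚ`: for every prime `ℓ`, `L_ℓ(W, T) = 1 − tT + δT²` with `t = (ℓ/p)·a_ℓ(f_V)`,
  `δ = (ℓ/p)²·ℓ𝟙_{ℓ∤N_V}` (`exists_localPolynomialAt_eq_of_twist_pStar`: `a_ℓ(E ⊗ χ_{p*}) = (ℓ/p)a_ℓ(E)`
  by the tree's `LFunction_quadraticTwist_pStar_apply`; `a_ℓ = −[T¹]L_ℓ` at EVERY prime,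
  `LFunction_primesEquiv_eq_neg_coeff_one`; `[T²]L_ℓ = ℓ·𝟙[good]`; bad primes away from `p` agree
  by `conductorExponent_eq_of_twist_pStar_of_ne` + `factorization_conductorNorm` + `dvd_conductorNorm_iff`;
  at `ℓ = p` both sides are `1`);
* §3 place by place over `K` (`rankinSelbergLocalFactorInv_genus_eq_localPolynomialAt`):
  `F_w(s) = L_w(W_K, N w^{−s})` — base change raises the Frobenius eigenvalues to the `f(w|ℓ)`-th power
  at places unramified in `K` for ANY reduction type and at ramified places of semistable reduction
  (tree `map_localPolynomialAt_baseChange_eq_of_ramificationIdxIn_eq_one` / `…_of_isSemistableAt`,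
  `ArtinFormalismSemistableLocalProofs`), and the genus character has the value `(ℓ/p)^{f(w|ℓ)}` at
  EVERY `w` (FILE 2; `0 = (p/p)^f` above `p`);
* §4 `rankinSelbergEulerProduct f χ_gal s = L(W_K, s) = L(W, s)·L(W^{(d_K)}, s)` on `re s > 3/2`
  (tree `hasProd_localPolynomialAt_inv_LSeries` — the curve-side Euler product converges there by the
  Hasse bound, which is why the Galois road and not the Hecke-currency Artin formalism (proved only on
  `re s > 2`) is used — and `LSeries_baseChange_quadratic_holds`), whence by continuation
  **`artinLink_genus : rankinSelbergDerivValue f χ_gal 1 = LDerivEK W K`** and its form from the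
  modularity fact `hasEntireLFunction_rat`.

Hypotheses of `artinLink_genus` (all met on the door, see the companion `…ArtinLinkGenusDoor.lean`):
`p` odd; `V`, `W` globally minimal, `C • (V ⊗ χ_{p*}) = W`, `W` ADDITIVE at `p` (the door's `Addv`);
`f` with `IsNewformOf V f` at level `N_V`; `K` quadratic Galois with ONE prime over `p` of
ramification index `1` (the frame's degree-one `𝔭`) and, at every rational prime, `K` unramified
OR `W` semistable (Heegner hypothesis: the primes of `N_W` split); `χ_gal` rational for `p*`
(the genus datum, `isRationalCharacterFor_of_genusDatum`); `L(W,s)`, `L(W^{(d_K)},s)` entire.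

References: Gross, MSRI Publ. 49 (2004) §2 p. 40, §13 p. 49; Nekovář, Math. Ann. 302 (1995)
(0.5); Silverman *AEC* V.2.3.1, X.2, Ex. 10.16, App. C §16; Ireland–Rosen Prop. 20.5.4 (b);
Diamond–Shurman §8.3; Neukirch I §8–§9.
-/

noncomputable section

open scoped NumberField NumberTheorySymbols Classical
open Field IsDedekindDomain NumberField Polynomial
open Literature.NumberTheory.GaloisRepresentations
open Literature.NumberTheory.EllipticCurves.ModularForms

-- D-0017 layout: summit = sub-problem, so `Summit.BirchSwinnertonDyer.BirchSwinnertonDyer.…` is the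
-- mandated namespace (same option as the route's sockets files).
set_option linter.dupNamespace false
set_option autoImplicit false

namespace Summit.BirchSwinnertonDyer.BirchSwinnertonDyer.Theorems.SchneiderFree

open Literature.NumberTheory.EllipticCurves

/-! ## §3 The place-by-place identity over `K`: `F_w(s) = L_w(W_K, N w^{−s})` -/

section PerPlace

open Rat.HeightOneSpectrum Literature.NumberTheory.QuadraticFields

/-- Two complex numbers with prescribed sum and product (roots of `X² − tX + δ`). [folklore] -/
private theorem exists_add_eq_and_mul_eq (t δ : ℂ) : ∃ α β : ℂ, α + β = t ∧ α * β = δ := by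
  obtain ⟨c, hc⟩ := IsAlgClosed.exists_pow_nat_eq (t ^ 2 - 4 * δ) two_pos
  refine ⟨(t + c) / 2, (t - c) / 2, by ring, ?_⟩
  linear_combination (-(1 : ℂ) / 4) * hc

/-- `aeval T (P.map ℤ→ℚ) = (P.map ℤ→ℂ).eval T` for an integral polynomial. [folklore] -/
private theorem aeval_map_int_eq_eval_map (P : ℤ[X]) (T : ℂ) :
    Polynomial.aeval T (P.map (Int.castRingHom ℚ)) = (P.map (Int.castRingHom ℂ)).eval T := by
  rw [Polynomial.aeval_def, Polynomial.eval₂_map, Polynomial.eval_map]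
  congr 1

variable {p : ℕ} [Fact p.Prime] {K : Type} [Field K] [NumberField K]

/-- **The place below.** For a finite place `w` of `K` with `ℓ = N(w ∩ ℤ)`: `w ∩ 𝓞_ℚ` is the place
of `ℚ` at `ℓ` and `N w = ℓ^{f(w|ℓ)}`, `f ≥ 1`. [cite: NeukirchANT1999, Ch. I §8 (8.2)] -/
theorem residueCard_eq_pow_inertiaDeg (w : HeightOneSpectrum (𝓞 K)) :
    w.residueCard = (primesEquiv (w.under (𝓞 ℚ)) : ℕ) ^ w.asIdeal.inertiaDeg (𝓞 ℚ) ∧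
      w.asIdeal.inertiaDeg (𝓞 ℚ) ≠ 0 := by
  set v := w.under (𝓞 ℚ) with hv
  haveI : w.asIdeal.LiesOver v.asIdeal := ⟨rfl⟩
  haveI := v.isMaximal
  haveI := w.isMaximal
  haveI : Module.Finite (𝓞 ℚ) (𝓞 K) := IsIntegralClosure.finite (𝓞 ℚ) ℚ K (𝓞 K)
  have h := Ideal.absNorm_eq_pow_inertiaDeg'_of_liesOver w.asIdeal v.asIdeal v.isPrime v.ne_bot
  rw [Ideal.inertiaDeg'_eq_inertiaDeg] at h
  refine ⟨?_, (Ideal.inertiaDeg_pos w.asIdeal (𝓞 ℚ)).ne'⟩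
  rw [HeightOneSpectrum.residueCard, h, ← HeightOneSpectrum.residueCard, Rat.residueCard_eq_natGenerator]
  rfl

variable (hp2 : p ≠ 2) (V W : WeierstrassCurve ℚ) [V.IsElliptic] [V.IsGloballyMinimal] [W.IsElliptic]
  [W.IsGloballyMinimal] (Ctw : WeierstrassCurve.VariableChange ℚ)
  (hC : Ctw • V.quadraticTwist ((-1 : ℚ) ^ (p / 2) * p) = W)
  (hadd : W.HasAdditiveReductionAt ((primesEquiv (R := 𝓞 ℚ)).symm ⟨p, Fact.out⟩))
  {N : ℕ} [NeZero N] {f : CuspForm (CongruenceSubgroup.Gamma0 N) 2} (hf : IsNewformOf V f)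
  (hN : N = V.conductorNorm ℤ) [IsGalois ℚ K]
  (χgal : absoluteGaloisGroup K →ₜ* ℂˣ)
  (hrat : Gross2004.IsRationalCharacterFor χgal ((-1 : ℤ) ^ (p / 2) * p))
  (hunr : ∃ 𝔭 : HeightOneSpectrum (𝓞 K), ((p : ℕ) : 𝓞 K) ∈ 𝔭.asIdeal ∧
    𝔭.asIdeal.ramificationIdx (𝓞 ℚ) = 1)
  (hram : ∀ v : HeightOneSpectrum (𝓞 ℚ), v.asIdeal.ramificationIdxIn (𝓞 K) = 1 ∨ W.IsSemistableAt v)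

include hp2 hrat hunr in
/-- **The genus character's value at `w` is `(ℓ/p)^{f(w|ℓ)}`** — uniformly at ALL places: off `p`
it is `J(N w | p) = J(ℓ^f | p)` (FILE 2 `heckeValueAt_genus_of_not_mem'`), above `p` both sides
vanish (`heckeValueAt_genus_of_mem`, `(p/p) = 0`, `f ≥ 1`). [cite: Gross2004, §3 p. 40] -/
theorem heckeValueAt_genus_eq_jacobiSym_pow (w : HeightOneSpectrum (𝓞 K)) :
    heckeValueAt χgal w =
      (J(((primesEquiv (w.under (𝓞 ℚ)) : ℕ) : ℤ) | p) : ℂ) ^ w.asIdeal.inertiaDeg (𝓞 ℚ) := by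
  have hp : p.Prime := Fact.out
  obtain ⟨hq, hf0⟩ := residueCard_eq_pow_inertiaDeg w
  set ℓ : ℕ := (primesEquiv (w.under (𝓞 ℚ)) : ℕ) with hℓ
  by_cases hw : ((p : ℕ) : 𝓞 K) ∈ w.asIdeal
  · -- above `p`: `ℓ = p`, both sides vanish
    have hmem : ((p : ℕ) : 𝓞 ℚ) ∈ (w.under (𝓞 ℚ)).asIdeal := by
      rw [HeightOneSpectrum.under_asIdeal, Ideal.under_def, Ideal.mem_comap, map_natCast]
      exact hw
    have hℓp : ℓ = p := by
      rw [hℓ, (natCast_mem_asIdeal_iff_eq_primesEquiv_symm _ hp).mp hmem, Equiv.apply_symm_apply]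
    rw [heckeValueAt_genus_of_mem hp2 χgal hrat hunr hw, hℓp, jacobiSym.mod_left, Int.emod_self,
      jacobiSym.zero_left hp.one_lt, Int.cast_zero, zero_pow hf0]
  · rw [heckeValueAt_genus_of_not_mem' hp2 χgal hrat hw, hq, Nat.cast_pow, jacobiSym.pow_left,
      Int.cast_pow]

include hp2 hC hadd hf hN hrat hunr hram in
/-- **The place-by-place identity (want W2, local form).** For every finite place `w` of `K`:
the Rankin–Selberg local factor of `f = f_V` twisted by the genus character `χ_gal` (GALOIS
currency) at `w` equals the local Euler factor of the base change `W_K` of `W = C • (V ⊗ χ_{p*})`: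
`F_w(s) = L_w(W_K, N w^{−s})`. Ingredients: the `ℓ`-local polynomial of `W` has coefficients
`((ℓ/p) a_ℓ(f), (ℓ/p)² e_ℓ)` (§2); base change to `K` raises the Frobenius eigenvalues to the
`f(w|ℓ)`-th power at places unramified in `K` (tree
`map_localPolynomialAt_baseChange_eq_of_ramificationIdxIn_eq_one`) and at ramified places of
semistable reduction (`…_of_isSemistableAt`); and `χ_gal` has the value `(ℓ/p)^{f(w|ℓ)}` at `w`.
[cite: Gross2004, §3 p. 40 and §13 p. 49] [cite: SilvermanAEC2009, V.2.3.1 and §C.16]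
[cite: Nekovar1995, (0.5) p. 611] -/
theorem rankinSelbergLocalFactorInv_genus_eq_localPolynomialAt (w : HeightOneSpectrum (𝓞 K))
    (s : ℂ) :
    rankinSelbergLocalFactorInv f χgal w s =
      Polynomial.aeval ((w.residueCard : ℂ) ^ (-s))
        (((W.baseChange K).localPolynomialAt w).map (Int.castRingHom ℚ)) := by
  have hp : p.Prime := Fact.out
  -- the place below, residue degree and cardinality
  set v := w.under (𝓞 ℚ) with hvdef
  have hw : w.asIdeal.under (𝓞 ℚ) = v.asIdeal := rfl
  obtain ⟨hq, hf0⟩ := residueCard_eq_pow_inertiaDeg w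
  set ℓ : ℕ := (primesEquiv v : ℕ) with hℓ
  set d : ℕ := w.asIdeal.inertiaDeg (𝓞 ℚ) with hd
  have hℓp : ℓ.Prime := (primesEquiv v).2
  have habs : Ideal.absNorm w.asIdeal = ℓ ^ d := hq
  -- the `ℓ`-local polynomial of `W`
  obtain ⟨t, δ, hL, ht, hδ⟩ := exists_localPolynomialAt_eq_of_twist_pStar hp2 V W Ctw hC hadd hf hN v
  set ε : ℂ := (J((ℓ : ℤ) | p) : ℂ) with hε
  set a : ℂ := cuspCoeff f ℓ with ha
  set e : ℂ := (if ℓ ∣ N then 0 else (ℓ : ℂ)) with he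
  obtain ⟨α₀, β₀, hadd0, hmul0⟩ := exists_add_eq_and_mul_eq a e
  have hvL : (W.localPolynomialAt v).map (Int.castRingHom ℂ) =
      (1 - C (ε * α₀) * X) * (1 - C (ε * β₀) * X) := by
    rw [hL]
    have h' : ((1 - C t * X + C δ * X ^ 2 : ℤ[X]).map (Int.castRingHom ℂ)) =
        (1 - C (t : ℂ) * X + C (δ : ℂ) * X ^ 2 : ℂ[X]) := by
      simp [Polynomial.map_sub, Polynomial.map_mul]
    rw [h', ht, hδ, ← hadd0, ← hmul0]
    simp only [C_mul, C_add, C_pow]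
    ring
  -- base change to `K`: eigenvalues raised to the `d`-th power
  have hwL : ((W.baseChange K).localPolynomialAt w).map (Int.castRingHom ℂ) =
      (1 - C ((ε * α₀) ^ d) * X) * (1 - C ((ε * β₀) ^ d) * X) := by
    rcases hram v with he1 | hsemi
    · exact W.map_localPolynomialAt_baseChange_eq_of_ramificationIdxIn_eq_one K hw he1 hvL
    · exact W.map_localPolynomialAt_baseChange_eq_of_isSemistableAt K hw hsemi hvL
  -- the value of the genus character at `w`
  have hχw : heckeValueAt χgal w = ε ^ d := heckeValueAt_genus_eq_jacobiSym_pow hp2 χgal hrat hunr w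
  rw [aeval_map_int_eq_eval_map, hwL,
    rankinSelbergLocalFactorInv_eq_mul_of_eigen f χgal hℓp hf0 habs s hadd0 hmul0 hχw]
  simp only [eval_mul, eval_sub, eval_one, eval_C, eval_X]

end PerPlace

/-! ## §4 The Euler-product identity on `re s > 3/2` and the ARTIN LINK `L′(f_V, χ, 1) = L′(E/K, 1)` -/

section Global

open Rat.HeightOneSpectrum Literature.NumberTheory.QuadraticFields

variable {p : ℕ} [Fact p.Prime] {K : Type} [Field K] [NumberField K]
  (hp2 : p ≠ 2) (V W : WeierstrassCurve ℚ) [V.IsElliptic] [V.IsGloballyMinimal] [W.IsElliptic]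
  [W.IsGloballyMinimal] (Ctw : WeierstrassCurve.VariableChange ℚ)
  (hC : Ctw • V.quadraticTwist ((-1 : ℚ) ^ (p / 2) * p) = W)
  (hadd : W.HasAdditiveReductionAt ((primesEquiv (R := 𝓞 ℚ)).symm ⟨p, Fact.out⟩))
  {N : ℕ} [NeZero N] {f : CuspForm (CongruenceSubgroup.Gamma0 N) 2} (hf : IsNewformOf V f)
  (hN : N = V.conductorNorm ℤ) [IsGalois ℚ K]
  (χgal : absoluteGaloisGroup K →ₜ* ℂˣ)
  (hrat : Gross2004.IsRationalCharacterFor χgal ((-1 : ℤ) ^ (p / 2) * p))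
  (hunr : ∃ 𝔭 : HeightOneSpectrum (𝓞 K), ((p : ℕ) : 𝓞 K) ∈ 𝔭.asIdeal ∧
    𝔭.asIdeal.ramificationIdx (𝓞 ℚ) = 1)
  (hram : ∀ v : HeightOneSpectrum (𝓞 ℚ), v.asIdeal.ramificationIdxIn (𝓞 K) = 1 ∨ W.IsSemistableAt v)

include hp2 hC hadd hf hN hrat hunr hram in
/-- **`L(f_V ⊗ K, χ_gal, s) = L(W_K, s)` on `re s > 3/2`** (Euler products): the Rankin–Selberg
Euler product of `f_V` against the genus character `χ_gal` (GALOIS currency) is the Hasse–Weil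
`L`-series of `W = C • (V ⊗ χ_{p*})` over `K` — place by place
(`rankinSelbergLocalFactorInv_genus_eq_localPolynomialAt`), the right-hand Euler product converging
for `re s > 3/2` (tree `hasProd_localPolynomialAt_inv_LSeries`, Hasse bound).
[cite: Gross2004, §3 p. 40 and §13 p. 49] [cite: SilvermanAEC2009, App. C §16] -/
theorem rankinSelbergEulerProduct_genus_eq_LSeries_baseChange {s : ℂ} (hs : 3 / 2 < s.re) :
    rankinSelbergEulerProduct f χgal s = (W.baseChange K).LSeries s := by
  rw [rankinSelbergEulerProduct, ← ((W.baseChange K).hasProd_localPolynomialAt_inv_LSeries hs).tprod_eq]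
  refine tprod_congr fun w ↦ ?_
  rw [rankinSelbergLocalFactorInv_genus_eq_localPolynomialAt hp2 V W Ctw hC hadd hf hN χgal hrat hunr
    hram w s]

include hp2 hC hadd hf hN hrat hunr hram in
/-- **`L(f_V ⊗ K, χ_gal, s) = L(W, s) · L(W^{(d_K)}, s)` on `re s > 3/2`** for the quadratic field
`K`: the previous identity composed with the PROVED Artin formalism of a quadratic base change
(`WeierstrassCurve.LSeries_baseChange_quadratic_holds`, Ireland–Rosen Prop. 20.5.4 (b)). This is
Gross's "`L(f, χ, s) = L(A₁, s) L(A₂, s)`" for the rational character of `d₁ = p*` WITHOUT the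
coprimality `(c, N) = 1` of the tree's cite-only `Gross2004.rankinLSeries_eq_mul_quadraticTwist`.
[cite: Gross2004, §2 p. 40] [cite: IrelandRosen1990, Ch. 20 §5 Prop. 20.5.4(b)] -/
theorem rankinSelbergEulerProduct_genus_eq_mul_LSeries (h2 : Module.finrank ℚ K = 2) {s : ℂ}
    (hs : 3 / 2 < s.re) :
    rankinSelbergEulerProduct f χgal s =
      W.LSeries s * (W.quadraticTwist (NumberField.discr K : ℚ)).LSeries s := by
  rw [rankinSelbergEulerProduct_genus_eq_LSeries_baseChange hp2 V W Ctw hC hadd hf hN χgal hrat hunr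
    hram hs]
  exact WeierstrassCurve.LSeries_baseChange_quadratic_holds W K h2 s hs

include hp2 hC hadd hf hN hrat hunr hram in
/-- **THE ARTIN LINK (want W2 of FINDING-door-c2-g8), PROVED: `L′(f_V, χ_gal, 1) = L′(E/K, 1)`.**
For `p` odd; `V`, `W` globally minimal elliptic over `ℚ` with `C • (V ⊗ χ_{p*}) = W` and `W`
additive at `p`; `f` the newform of `V` at level `N_V`; `K` a quadratic Galois number field with a
prime over `p` of ramification index `1` and such that at every prime ramified in `K` the curve `W`
is semistable; `χ_gal` a character of `Γ_K` rational for `p*` (the genus character); and `L(W, s)`,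
`L(W^{(d_K)}, s)` entire (modularity): the derivative at `s = 1` of the continued Rankin–Selberg
`L`-function `rankinSelbergDerivValue f χ_gal 1` equals `LDerivEK W K = (L(W,·)L(W^{(d_K)},·))′(1)`.
No `(c, N_V) = 1`, no cite-only input. [cite: Gross2004, §2 p. 40] [cite: Nekovar1995, (0.5) p. 611] -/
theorem artinLink_genus (h2 : Module.finrank ℚ K = 2) (hEW : W.HasEntireLFunction)
    (hED : (W.quadraticTwist (NumberField.discr K : ℚ)).HasEntireLFunction) :
    rankinSelbergDerivValue f χgal 1 = LDerivEK W K := by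
  have hd0 : ((NumberField.discr K : ℤ) : ℚ) ≠ 0 := by exact_mod_cast NumberField.discr_ne_zero K
  haveI := W.isElliptic_quadraticTwist hd0
  rw [LDerivEK]
  refine rankinSelbergDerivValue_eq
    ((W.differentiable_entireLFunction hEW).mul
      ((W.quadraticTwist (NumberField.discr K : ℚ)).differentiable_entireLFunction hED)) (fun s hs ↦ ?_) 1
  change W.entireLFunction s * (W.quadraticTwist (NumberField.discr K : ℚ)).entireLFunction s = _
  rw [W.entireLFunction_eq_LSeries hEW hs,
    (W.quadraticTwist (NumberField.discr K : ℚ)).entireLFunction_eq_LSeries hED hs,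
    rankinSelbergEulerProduct_genus_eq_mul_LSeries hp2 V W Ctw hC hadd hf hN χgal hrat hunr hram h2 hs]

include hp2 hC hadd hf hN hrat hunr hram in
/-- The Artin link from the MODULARITY named fact `hasEntireLFunction_rat` (entire continuation of
`L(E^{(d)}, s)` for every `E/ℚ`, BCDT) — the form consumed on the door.
[cite: Gross2004, §2 p. 40] [cite: BCDTJAMS2001, Theorem A] -/
theorem artinLink_genus_of_hasEntireLFunction_rat (h2 : Module.finrank ℚ K = 2)
    (hmod : WeierstrassCurve.hasEntireLFunction_rat) :
    rankinSelbergDerivValue f χgal 1 = LDerivEK W K := by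
  have hd0 : ((NumberField.discr K : ℤ) : ℚ) ≠ 0 := by exact_mod_cast NumberField.discr_ne_zero K
  haveI := W.isElliptic_quadraticTwist hd0
  exact artinLink_genus hp2 V W Ctw hC hadd hf hN χgal hrat hunr hram h2 (hmod W) (hmod _)

end Global

end Summit.BirchSwinnertonDyer.BirchSwinnertonDyer.Theorems.SchneiderFree

end
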